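import Summits.QuantumFields.YangMills.Theorems.UnitScaleTiltFluctuationComparisonRegPrGlobalSlackLegKernelBudgetPointwise
import Summits.QuantumFields.YangMills.Theorems.UnitScaleTiltFluctuationComparisonRegPrGlobalSlackCanonicalPolymersMatched
import HarnessLib

/-!
# `UnitScaleTiltFluctuationComparisonRegPrGlobalSlackLegNaturalChartKernelTwoRun` — THE TWO-RUN KERNEL ROW (K) OF THE NATURAL CHART FAMILY `Φ♮[Φ₀, N]` SPLITS INTO THE BACKGROUND
# FAMILY'S ROW OFF THE BLOCKS AND PRINT'S POINTWISE TWO-RUN ROW OF THE (43) KERNELS AT THE BLOCKS (crux `FluctuationComparisonRegPrIntL`, stmt-QuantumFields-20520, STUB 3⁗χ(v4);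
# cell `pub/ym-inputs`, seat ym-inputs-p11 (g4); count-neutral helper, def-free, registry untouched)

WHY.  The natural-object two-run doors of 3⁗χ(v4) (✓`k1aLegRowsDisplayTwoRunChiAtV4_of_kernelRows` and its `Sel` / `Local` / `Coherent` ports) read the NATURAL CHART FAMILY
`Φ♮[birthChartRows q, N] K b Y := if Y = blockSet K (1+b) y then P_{N K b y} else birthChartRows q K b Y` and display ONE monolithic cross-cut-off kernel row (K) `FlatKernelLegCauchyΦ D Φ♮
(canonLegDist F) κ′ κ a C`: «`‖(kerT Φ♮ K b Y d − ker Φ♮ K b Y d) ∘ D_w^{⊗d}‖ ≤ C·e^{−κ𝓛(Y)}·(L^{−(1+b)})^a` at every listed `Y`, `d ∈ [2,7)`» (run `K+1`'s flat kernel at `(b+1, refineSet Y)`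
transported along `matchBond`, against run `K`'s).  The refinement respects the block dichotomy — `refineSet (blockSet K (1+b) y) = blockSet (K+1) (2+b) (liftSite y)` (✓`refineSet_blockSet`),
and a refined point set is a run-`(K+1)` block only if the point set is a run-`K` block (§1) — so (K)[Φ♮] is TWO rows: off the blocks both runs read `Φ₀`; at a block both read kernel
polynomials and `P_{N′} ∘ transport − P_N = P_{Ñ}`, `Ñ n c := N (K+1) (b+1) (liftSite y) n (matchBond ∘ c) − N K b y n c` (§2) — the two-cut-off comparison of the field-independent (43)
kernels, [King1986] Prop. 3.6 (3.55)–(3.56) in shape.  This file proves (K)[Φ♮[Φ₀, N]] from the two rows, the block row in PRINT'S POINTWISE form (as ✓`kernelBudget_blockSet_of_pointwise`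
did for the budget (k)):
* §1 `exists_blockSet_eq_of_refineSet_eq_blockSet`, `forall_blockSet_ne_refineSet`, `naturalChart_succ_refineSet_blockSet` / `…_of_forall_ne`, `ker(T)_naturalChart_of_forall_ne`.
* §2 `contDiff_legPoly`, `legPoly_transport(_sub)` (`Fintype.sum_equiv` along `matchBond`), `iteratedFDeriv_legPoly_comp_transport`, ★ **`kerT_sub_ker_naturalChart_blockSet`**
  (`kerT Φ♮ − ker Φ♮ = Dᵈ P_{Ñ}(0)` at a block), ★ **`norm_iteratedFDeriv_legPoly_comp_legL_le`** (`‖Dᵈ P_M(0) ∘ D_w^{⊗d}‖ ≤ B·(max 1 (12/ρ))⁶` from the leg-weighted budget `≤ B`: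
  ✓`iteratedFDeriv_comp_diag_zero`, ✓`chartAnalyticityAsCited_legPoly_comp_diag`, ✓`norm_iteratedFDeriv_zero_le_uniform`).
* §3 (`𝕍 := 𝔤ᶜ`, rows datum, `canonLegDist`): ★ **`twoRunKernelBudget_blockSet_of_pointwise`** (budget of `Ñ` from the pointwise row, ✓`kernelBudget_blockSet_of_pointwise` BY NAME on the
  chart-level slice of `Ñ`); ★★ **`flatKernelLegCauchyΦ_naturalChart_rows_of_offBlock_of_pointwise`**: (K)[Φ♮[Φ₀, N]] ⇐ (K_b) «listed non-block `Y`: `‖(kerT Φ₀ − ker Φ₀) K b Y d ∘ D_w‖ ≤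
  C₀·e^{−κ𝓛}·(L^{−(1+b)})^a`» + (K₀) «listed block, `n ∈ [2,7)`, `c`: `‖Ñ n c‖ ≤ A·Πᵢ e^{−κ₁·canonLegDist(cᵢ)}·(L^{−(1+b)})^a`» (`κ₁ > κ′`), constant `max C₀ (A·e^{κL³}·Σ_{n∈[2,7)} (n!)⁻¹
  (legSumConst(κ₁−κ′)(1+L³)·6)ⁿ)` (Cauchy radius `12`); `twoRunKernelConst_nonneg`.
* §4 ★★ **`flatKernelLegCauchyΦ_naturalChart_chiV4_of_offBlock_of_pointwise`** — the doors' conjunct (K), letter for letter (`dataOfV4chi`, `Φ₀ := birthChartRows (toRows ∘ p)`, `κ := 𝔠.κ`).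

WHAT THIS RECORDS (honest label, numbers unchanged).  (K)[Φ♮] = (K₀) the pointwise two-cut-off comparison of the (43) kernels + (K_b) the two-cut-off comparison of the flat kernels of the
birth charts `Ψ_X + Λ_X` (G3D-01 / G3D-07) at matched listed non-block point sets (incl. the dummy top, `refineSet univ = univ`) — both the definer's, both UNPRINTED for non-abelian `d = 3`
(E2 = NO).  Discharged: the block case analysis across `refineSet`, the transport re-indexing and chain rules, the Cauchy route, the leg-sum bookkeeping.  No door is typed (LEAD's pen).

HONEST SCOPE.  Lattice geometry + Mathlib calculus over landed lemmas; (K₀), (K_b) are HYPOTHESES; nothing of [King1986] / [Balaban1985UV3] is asserted; no stub / crux / registry object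
touched; no summit / rung / gap claim (YM₃ on T³ is ladder rung R3, not the Clay problem / 𝕋⁴ / a mass gap).  L-floor: none.

References: C. King, CMP 102 (1986) 649–677 [King1986] (Prop. 3.6 (3.55)–(3.56) p.662); T. Bałaban, CMP 102 (1985) 255–275 [Balaban1985UV3] (Prop. 3 (34) p.264, (33) p.264,
(43)–(45) pp.266–267, (59)–(61) pp.270–271); T. Bałaban, CMP 109 (1987) 249–301 [Balaban1987RG1] ((0.1) p.251, (0.3) p.252).
-/


set_option autoImplicit false

noncomputable section

open scoped BigOperators Nat
open Metric Finset
open Literature.MathematicalPhysics.QuantumFieldTheory.Balaban1983to89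
open Literature.MathematicalPhysics.QuantumFieldTheory.Balaban1983to89.T3ContinuumYM3Torus
open Literature.MathematicalPhysics.QuantumFieldTheory.Balaban1983to89.T3AlphaInputsAC (AlphaDataT3)
open Literature.MathematicalPhysics.QuantumFieldTheory.Balaban1983to89.T3AlphaPolymerSocket
open Literature.MathematicalPhysics.QuantumFieldTheory.Balaban1985CMP102
open Literature.MathematicalPhysics.QuantumFieldTheory.Balaban1985CMP102.Setting
open Literature.MathematicalPhysics.QuantumFieldTheory.Balaban1985CMP102.Binders (ChartAnalyticityAsCited)
open Summit.QuantumFields.Balaban3D.Carriers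
open Summit.QuantumFields.Balaban3D.Proofs.Primitives
open Summit.QuantumFields.Balaban3D.Proofs.GroupModelLieC (lieC)
open Summit.QuantumFields.YangMills.Theorems
open Summit.QuantumFields.YangMills.Theorems.TwoCutoffTowerLimit
open Summit.QuantumFields.YangMills.Theorems.GlobalSlackKernelMatching
open Summit.QuantumFields.YangMills.Theorems.GlobalSlackCanonicalPolymers

namespace Summit.QuantumFields.YangMills.Theorems.GlobalSlackKernelLeg

/-! ## §1 Blocks across the refinement and the natural chart family of run `K + 1` at the refined index -/

section Geometry

variable {F : T3Family} {𝕍 : Type} [NormedAddCommGroup 𝕍] [NormedSpace ℂ 𝕍]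
  (Φ₀ : ChartFam 𝕍 F)
  (N : (K b : ℕ) → Site (F.P K) (1 + b) → (n : ℕ) → (Fin n → PBond (F.P K) b) → ContinuousMultilinearMap ℂ (fun _ : Fin n => 𝕍) ℂ)

omit [NormedAddCommGroup 𝕍] [NormedSpace ℂ 𝕍] in
/-- **A REFINED POINT SET IS A BLOCK OF RUN `K+1` ONLY IF THE POINT SET IS A BLOCK OF RUN `K`** (`liftSite` bijective, `refineSet` injective). [cite: Balaban1987RG1, (0.1) p.251] -/
theorem exists_blockSet_eq_of_refineSet_eq_blockSet {K b : ℕ} (hb : 1 + b ≤ F.m + K) {Y : Set (Site (F.P K) 0)} {y' : Site (F.P (K + 1)) (1 + b + 1)}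
    (h : blockSet (K + 1) (1 + b + 1) y' = refineSet F K Y) : ∃ y : Site (F.P K) (1 + b), blockSet K (1 + b) y = Y := by
  refine ⟨(liftSite F K (1 + b)).symm y', refineSet_injective K ?_⟩
  rw [refineSet_blockSet K (1 + b) hb, Equiv.apply_symm_apply]
  exact h

omit [NormedAddCommGroup 𝕍] [NormedSpace ℂ 𝕍] in
/-- Off the blocks of run `K`, the refined point set is off the blocks of run `K+1`. [cite: Balaban1987RG1, (0.1) p.251] -/
theorem forall_blockSet_ne_refineSet {K b : ℕ} (hb : 1 + b ≤ F.m + K) {Y : Set (Site (F.P K) 0)} (hY : ∀ y : Site (F.P K) (1 + b), blockSet K (1 + b) y ≠ Y) :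
    ∀ y' : Site (F.P (K + 1)) (1 + (b + 1)), blockSet (K + 1) (1 + (b + 1)) y' ≠ refineSet F K Y :=
  fun y' h => (exists_blockSet_eq_of_refineSet_eq_blockSet (F := F) hb (y' := y') h).elim fun y hy => hY y hy

open Classical in
/-- **RUN `K+1`'s NATURAL CHART AT A REFINED BLOCK IS THE KERNEL POLYNOMIAL OF THE LIFTED BLOCK** `P_{N (K+1) (b+1) (liftSite y)}`. [cite: Balaban1985UV3, (43) p.266; Balaban1987RG1, (0.1) p.251] -/
theorem naturalChart_succ_refineSet_blockSet {K b : ℕ} (hb : 1 + b ≤ F.m + K) (y : Site (F.P K) (1 + b)) :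
    (fun K b Y =>
        if h : ∃ y : Site (F.P K) (1 + b), blockSet K (1 + b) y = Y then
          (fun x : PBond (F.P K) b → 𝕍 => ∑ n ∈ Finset.Ico 2 7, ((n ! : ℂ))⁻¹ * ∑ c : Fin n → PBond (F.P K) b, N K b h.choose n c (fun i => x (c i)))
        else Φ₀ K b Y : ChartFam 𝕍 F) (K + 1) (b + 1) (refineSet F K (blockSet K (1 + b) y)) =
      fun x => ∑ n ∈ Finset.Ico 2 7, ((n ! : ℂ))⁻¹ * ∑ c : Fin n → PBond (F.P (K + 1)) (b + 1), N (K + 1) (b + 1) (liftSite F K (1 + b) y) n c (fun i => x (c i)) := by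
  rw [refineSet_blockSet K (1 + b) hb y]
  exact naturalChart_blockSet Φ₀ N (show 1 + (b + 1) ≤ F.m + (K + 1) by omega) (liftSite F K (1 + b) y)

open Classical in
/-- **OFF THE BLOCKS, RUN `K+1`'s NATURAL CHART AT THE REFINED INDEX IS THE BACKGROUND CHART**. [cite: Balaban1985UV3, (33) p.264; Balaban1987RG1, (0.1) p.251] -/
theorem naturalChart_succ_refineSet_of_forall_ne {K b : ℕ} (hb : 1 + b ≤ F.m + K) {Y : Set (Site (F.P K) 0)}
    (hY : ∀ y : Site (F.P K) (1 + b), blockSet K (1 + b) y ≠ Y) :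
    (fun K b Y =>
        if h : ∃ y : Site (F.P K) (1 + b), blockSet K (1 + b) y = Y then
          (fun x : PBond (F.P K) b → 𝕍 => ∑ n ∈ Finset.Ico 2 7, ((n ! : ℂ))⁻¹ * ∑ c : Fin n → PBond (F.P K) b, N K b h.choose n c (fun i => x (c i)))
        else Φ₀ K b Y : ChartFam 𝕍 F) (K + 1) (b + 1) (refineSet F K Y) = Φ₀ (K + 1) (b + 1) (refineSet F K Y) :=
  naturalChart_of_forall_ne Φ₀ N (forall_blockSet_ne_refineSet (F := F) hb hY)

open Classical in
/-- Off the blocks the flat kernels of the natural chart family are the background family's. [cite: Balaban1985UV3, (33) p.264; King1986, (3.55) p.662] -/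
theorem ker_naturalChart_of_forall_ne {K b : ℕ} {Y : Set (Site (F.P K) 0)} (hY : ∀ y : Site (F.P K) (1 + b), blockSet K (1 + b) y ≠ Y) (d : ℕ) :
    ker (fun K b Y =>
        if h : ∃ y : Site (F.P K) (1 + b), blockSet K (1 + b) y = Y then
          (fun x : PBond (F.P K) b → 𝕍 => ∑ n ∈ Finset.Ico 2 7, ((n ! : ℂ))⁻¹ * ∑ c : Fin n → PBond (F.P K) b, N K b h.choose n c (fun i => x (c i)))
        else Φ₀ K b Y : ChartFam 𝕍 F) K b Y d = ker Φ₀ K b Y d := by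
  unfold ker
  rw [naturalChart_of_forall_ne Φ₀ N hY]

open Classical in
/-- Off the blocks the transported flat kernels of the natural chart family are the background family's (`1 + b ≤ m + K`). [cite: King1986, Prop. 3.6 (3.56) p.662] -/
theorem kerT_naturalChart_of_forall_ne {K b : ℕ} (hb : 1 + b ≤ F.m + K) {Y : Set (Site (F.P K) 0)} (hY : ∀ y : Site (F.P K) (1 + b), blockSet K (1 + b) y ≠ Y) (d : ℕ) :
    kerT (fun K b Y =>
        if h : ∃ y : Site (F.P K) (1 + b), blockSet K (1 + b) y = Y then
          (fun x : PBond (F.P K) b → 𝕍 => ∑ n ∈ Finset.Ico 2 7, ((n ! : ℂ))⁻¹ * ∑ c : Fin n → PBond (F.P K) b, N K b h.choose n c (fun i => x (c i)))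
        else Φ₀ K b Y : ChartFam 𝕍 F) K b Y d = kerT Φ₀ K b Y d := by
  unfold kerT ker
  rw [naturalChart_succ_refineSet_of_forall_ne Φ₀ N hb hY]

end Geometry

/-! ## §2 At a block: the two-run kernel difference is the flat kernel of the kernel polynomial of the DIFFERENCE FAMILY -/

section Block

variable {F : T3Family} {𝕍 : Type} [NormedAddCommGroup 𝕍] [NormedSpace ℂ 𝕍]

/-- The leg-indexed kernel polynomial is smooth (it is entire: a finite power series). [folklore] -/
theorem contDiff_legPoly {ι : Type*} [Fintype ι] (M : (n : ℕ) → (Fin n → ι) → ContinuousMultilinearMap ℂ (fun _ : Fin n => 𝕍) ℂ) {m : WithTop ℕ∞} :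
    ContDiff ℂ m (fun x : ι → 𝕍 => ∑ n ∈ Finset.Ico 2 7, ((n ! : ℂ))⁻¹ * ∑ c : Fin n → ι, M n c (fun i => x (c i))) := by
  rw [legPoly_eq_polyChart]
  exact contDiff_iff_contDiffAt.2 fun x =>
    ((hasFiniteFPowerSeriesOnBall_polyChart _).toHasFPowerSeriesOnBall.analyticAt_of_mem (by simp)).contDiffAt

/-- **THE RUN-`(K+1)` KERNEL POLYNOMIAL READ THROUGH THE BOND TRANSPORT IS A RUN-`K` KERNEL POLYNOMIAL** with the legs re-indexed along `matchBond`: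
`P_{N′}(T x) = Σ_n (n!)⁻¹ Σ_c N′ n (matchBond ∘ c) (x ∘ c)`. [cite: Balaban1987RG1, (0.1) p.251; King1986, (3.55) p.662] -/
theorem legPoly_transport (K b : ℕ) (N' : (n : ℕ) → (Fin n → PBond (F.P (K + 1)) (b + 1)) → ContinuousMultilinearMap ℂ (fun _ : Fin n => 𝕍) ℂ)
    (x : PBond (F.P K) b → 𝕍) :
    (∑ n ∈ Finset.Ico 2 7, ((n ! : ℂ))⁻¹ * ∑ c' : Fin n → PBond (F.P (K + 1)) (b + 1), N' n c' (fun i => transport 𝕍 F K b x (c' i))) =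
      ∑ n ∈ Finset.Ico 2 7, ((n ! : ℂ))⁻¹ * ∑ c : Fin n → PBond (F.P K) b, N' n (fun i => matchBond F K b (c i)) (fun i => x (c i)) := by
  refine Finset.sum_congr rfl fun n _ => ?_
  congr 1
  refine (Fintype.sum_equiv (Equiv.arrowCongr (Equiv.refl (Fin n)) (matchBond F K b)) _ _ fun c => ?_).symm
  simp only [Equiv.arrowCongr_apply, Function.comp_apply, transport_apply, Equiv.symm_apply_apply]
  rfl

/-- **THE TWO-RUN DIFFERENCE OF KERNEL POLYNOMIALS IS THE KERNEL POLYNOMIAL OF `Ñ n c := N′ n (matchBond ∘ c) − N n c`**. [cite: King1986, Prop. 3.6 (3.55)-(3.56) p.662] -/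
theorem legPoly_transport_sub (K b : ℕ) (N' : (n : ℕ) → (Fin n → PBond (F.P (K + 1)) (b + 1)) → ContinuousMultilinearMap ℂ (fun _ : Fin n => 𝕍) ℂ)
    (N₀ : (n : ℕ) → (Fin n → PBond (F.P K) b) → ContinuousMultilinearMap ℂ (fun _ : Fin n => 𝕍) ℂ) (x : PBond (F.P K) b → 𝕍) :
    (∑ n ∈ Finset.Ico 2 7, ((n ! : ℂ))⁻¹ * ∑ c' : Fin n → PBond (F.P (K + 1)) (b + 1), N' n c' (fun i => transport 𝕍 F K b x (c' i))) -
        ∑ n ∈ Finset.Ico 2 7, ((n ! : ℂ))⁻¹ * ∑ c : Fin n → PBond (F.P K) b, N₀ n c (fun i => x (c i)) =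
      ∑ n ∈ Finset.Ico 2 7, ((n ! : ℂ))⁻¹ * ∑ c : Fin n → PBond (F.P K) b, (N' n (fun i => matchBond F K b (c i)) - N₀ n c) (fun i => x (c i)) := by
  rw [legPoly_transport, ← Finset.sum_sub_distrib]
  refine Finset.sum_congr rfl fun n _ => ?_
  rw [← mul_sub, ← Finset.sum_sub_distrib]
  rfl

/-- **THE FLAT KERNEL OF `P_{N′} ∘ T` IS THE FLAT KERNEL OF `P_{N′}` PRECOMPOSED WITH `T`** (chain rule for the linear transport, `T 0 = 0`). [cite: King1986, Prop. 3.6 (3.56) p.662] -/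
theorem iteratedFDeriv_legPoly_comp_transport (K b : ℕ) (N' : (n : ℕ) → (Fin n → PBond (F.P (K + 1)) (b + 1)) → ContinuousMultilinearMap ℂ (fun _ : Fin n => 𝕍) ℂ) (d : ℕ) :
    iteratedFDeriv ℂ d (fun x : PBond (F.P K) b → 𝕍 =>
        ∑ n ∈ Finset.Ico 2 7, ((n ! : ℂ))⁻¹ * ∑ c' : Fin n → PBond (F.P (K + 1)) (b + 1), N' n c' (fun i => transport 𝕍 F K b x (c' i))) 0 =
      (iteratedFDeriv ℂ d (fun x' : PBond (F.P (K + 1)) (b + 1) → 𝕍 =>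
          ∑ n ∈ Finset.Ico 2 7, ((n ! : ℂ))⁻¹ * ∑ c' : Fin n → PBond (F.P (K + 1)) (b + 1), N' n c' (fun i => x' (c' i))) 0).compContinuousLinearMap
        fun _ => transport 𝕍 F K b := by
  have h := (transport 𝕍 F K b).iteratedFDeriv_comp_right (contDiff_legPoly (𝕍 := 𝕍) N' (m := d)) 0 (i := d) le_rfl
  rw [map_zero] at h
  exact h

variable (Φ₀ : ChartFam 𝕍 F)
  (N : (K b : ℕ) → Site (F.P K) (1 + b) → (n : ℕ) → (Fin n → PBond (F.P K) b) → ContinuousMultilinearMap ℂ (fun _ : Fin n => 𝕍) ℂ)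

open Classical in
/-- ★ **AT A LISTED BLOCK THE TWO-RUN KERNEL DIFFERENCE OF THE NATURAL CHART FAMILY IS THE FLAT KERNEL OF `P_{Ñ}`**, `Ñ n c := N (K+1) (b+1) (liftSite y) n (matchBond ∘ c) − N K b y n c`:
`kerT Φ♮ K b (blockSet y) d − ker Φ♮ K b (blockSet y) d = Dᵈ P_{Ñ}(0)` (`1 + b ≤ m + K`). [cite: King1986, Prop. 3.6 (3.55)-(3.56) p.662; Balaban1985UV3, (43) p.266] -/
theorem kerT_sub_ker_naturalChart_blockSet {K b : ℕ} (hb : 1 + b ≤ F.m + K) (y : Site (F.P K) (1 + b)) (d : ℕ) :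
    kerT (fun K b Y =>
          if h : ∃ y : Site (F.P K) (1 + b), blockSet K (1 + b) y = Y then
            (fun x : PBond (F.P K) b → 𝕍 => ∑ n ∈ Finset.Ico 2 7, ((n ! : ℂ))⁻¹ * ∑ c : Fin n → PBond (F.P K) b, N K b h.choose n c (fun i => x (c i)))
          else Φ₀ K b Y : ChartFam 𝕍 F) K b (blockSet K (1 + b) y) d -
        ker (fun K b Y =>
          if h : ∃ y : Site (F.P K) (1 + b), blockSet K (1 + b) y = Y then
            (fun x : PBond (F.P K) b → 𝕍 => ∑ n ∈ Finset.Ico 2 7, ((n ! : ℂ))⁻¹ * ∑ c : Fin n → PBond (F.P K) b, N K b h.choose n c (fun i => x (c i)))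
          else Φ₀ K b Y : ChartFam 𝕍 F) K b (blockSet K (1 + b) y) d =
      iteratedFDeriv ℂ d (fun x : PBond (F.P K) b → 𝕍 =>
        ∑ n ∈ Finset.Ico 2 7, ((n ! : ℂ))⁻¹ * ∑ c : Fin n → PBond (F.P K) b,
          (N (K + 1) (b + 1) (liftSite F K (1 + b) y) n (fun i => matchBond F K b (c i)) - N K b y n c) (fun i => x (c i))) 0 := by
  unfold kerT ker
  rw [naturalChart_succ_refineSet_blockSet Φ₀ N hb y, naturalChart_blockSet Φ₀ N hb y, ← iteratedFDeriv_legPoly_comp_transport]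
  have h1 : ContDiff ℂ d (fun x : PBond (F.P K) b → 𝕍 =>
      ∑ n ∈ Finset.Ico 2 7, ((n ! : ℂ))⁻¹ * ∑ c' : Fin n → PBond (F.P (K + 1)) (b + 1),
        N (K + 1) (b + 1) (liftSite F K (1 + b) y) n c' (fun i => transport 𝕍 F K b x (c' i))) :=
    (contDiff_legPoly (𝕍 := 𝕍) (N (K + 1) (b + 1) (liftSite F K (1 + b) y)) (m := d)).comp (transport 𝕍 F K b).contDiff
  have h2 : ContDiff ℂ d (fun x : PBond (F.P K) b → 𝕍 => ∑ n ∈ Finset.Ico 2 7, ((n ! : ℂ))⁻¹ * ∑ c : Fin n → PBond (F.P K) b, N K b y n c (fun i => x (c i))) :=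
    contDiff_legPoly (𝕍 := 𝕍) (N K b y) (m := d)
  rw [← iteratedFDeriv_sub_apply h1.contDiffAt h2.contDiffAt]
  congr 1
  funext x
  exact legPoly_transport_sub K b (N (K + 1) (b + 1) (liftSite F K (1 + b) y)) (N K b y) x

/-- **OPERATOR NORM OF THE LEG-WEIGHTED FLAT KERNEL OF A KERNEL POLYNOMIAL FROM ITS LEG-WEIGHTED BUDGET** (Cauchy estimates on the leg-rescaled chart, orders `d ≤ 6`): if
`Σ_{n∈[2,7)} (n!)⁻¹ Σ_c ‖M n c‖·(Πᵢ e^{κ′ d(cᵢ)})·(ρ/2)ⁿ ≤ B` then `‖Dᵈ P_M(0) ∘ D_w^{⊗d}‖ ≤ B·(max 1 (12/ρ))⁶` (`iteratedFDeriv_comp_diag_zero`, `chartAnalyticityAsCited_legPoly_comp_diag`,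
`norm_iteratedFDeriv_zero_le_uniform`). [cite: Balaban1985UV3, Prop. 3 (34) p.264, (43) p.266, (45) p.267; King1986, (3.55) p.662] -/
theorem norm_iteratedFDeriv_legPoly_comp_legL_le (dist : LegDist F) (κ' : ℝ) (K b : ℕ) (Y : Set (Site (F.P K) 0))
    (M : (n : ℕ) → (Fin n → PBond (F.P K) b) → ContinuousMultilinearMap ℂ (fun _ : Fin n => 𝕍) ℂ) {ρ B : ℝ} (hρ : 0 < ρ)
    (hB : ∑ n ∈ Finset.Ico 2 7, ((n ! : ℝ))⁻¹ * ∑ c : Fin n → PBond (F.P K) b, ‖M n c‖ * (∏ i, Real.exp (κ' * dist K b Y (c i))) * (ρ / 2) ^ n ≤ B)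
    {d : ℕ} (hd : d ≤ 6) :
    ‖(iteratedFDeriv ℂ d (fun x : PBond (F.P K) b → 𝕍 => ∑ n ∈ Finset.Ico 2 7, ((n ! : ℂ))⁻¹ * ∑ c : Fin n → PBond (F.P K) b, M n c (fun i => x (c i))) 0).compContinuousLinearMap
        fun _ => legL 𝕍 dist κ' K b Y‖ ≤ B * (max 1 (12 / ρ)) ^ 6 := by
  have hB' : ∑ n ∈ Finset.Ico 2 7, ((n ! : ℝ))⁻¹ * ∑ c : Fin n → PBond (F.P K) b, ‖M n c‖ * (∏ i, ‖legW dist κ' K b Y (c i)‖) * (ρ / 2) ^ n ≤ B := by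
    simp only [norm_legW]
    exact hB
  have hc := chartAnalyticityAsCited_legPoly_comp_diag M (legW dist κ' K b Y) (legW_ne_zero dist κ' K b Y) hρ hB'
  have h := norm_iteratedFDeriv_zero_le_uniform hc hd
  have e := iteratedFDeriv_comp_diag_zero
    (fun x : PBond (F.P K) b → 𝕍 => ∑ n ∈ Finset.Ico 2 7, ((n ! : ℂ))⁻¹ * ∑ c : Fin n → PBond (F.P K) b, M n c (fun i => x (c i)))
    (legW dist κ' K b Y) (legW_ne_zero dist κ' K b Y) d
  rw [e] at h
  exact h

end Block

/-! ## §3 (K) for the natural chart family from the background row off the blocks and PRINT'S POINTWISE two-run row of the (43) kernels -/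

section Rows

variable {F : T3Family} {𝔠 : AlphaConsts F.L (suGroupModel 2).N} {γ : ℝ} {hγ : 0 < γ} {hγ1 : γ ≤ (min 𝔠.gamma0 1) ^ 2}
  (q : ∀ K, AlphaInputsT3AC.PkgCoreRows F 𝔠 γ hγ hγ1 K)
  (Φ₀ : ChartFam ↥(lieC (suGroupModel 2)) F)
  (N : (K b : ℕ) → Site (F.P K) (1 + b) → (n : ℕ) → (Fin n → PBond (F.P K) b) → ContinuousMultilinearMap ℂ (fun _ : Fin n => ↥(lieC (suGroupModel 2))) ℂ)

/-- ★ **THE LEG-WEIGHTED BUDGET OF THE TWO-RUN DIFFERENCE FAMILY `Ñ` AT A LISTED BLOCK FROM THE POINTWISE TWO-RUN ROW** (radius `ρ ≥ 0`, decay `κ ≥ 0`, `κ′ < κ₁`):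
`Σ_{n∈[2,7)} (n!)⁻¹ Σ_c ‖Ñ n c‖·Πᵢe^{κ′d(cᵢ)}·(ρ/2)ⁿ ≤ (A·e^{κL³}·Σ_{n∈[2,7)} (n!)⁻¹ (legSumConst(κ₁−κ′)(1+L³)ρ/2)ⁿ)·e^{−κ𝓛}·(L^{−(1+b)})^a` — ✓`kernelBudget_blockSet_of_pointwise` BY NAME on
the chart-level-`b` slice of `Ñ` with the constant `A·(L^{−(1+b)})^a`. [cite: King1986, Prop. 3.6 (3.56) p.662; Balaban1985UV3, (43) p.266, (45) p.267] -/
theorem twoRunKernelBudget_blockSet_of_pointwise {κ' κ₁ κ A a ρ : ℝ} (hκ' : κ' < κ₁) (hκ : 0 ≤ κ) (hA : 0 ≤ A) (hρ : 0 ≤ ρ)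
    (hK0 : ∀ (K k b : ℕ) (y : Site (F.P K) (1 + b)), blockSet K (1 + b) y ∈ canonLocRows q K k (Hist.triv (F.P K) k) (1 + b) →
      ∀ n ∈ Finset.Ico 2 7, ∀ c : Fin n → PBond (F.P K) b,
        ‖N (K + 1) (b + 1) (liftSite F K (1 + b) y) n (fun i => matchBond F K b (c i)) - N K b y n c‖ ≤
          A * (∏ i, Real.exp (-(κ₁ * canonLegDist F K b (blockSet K (1 + b) y) (c i)))) * (((F.L : ℝ) ^ (1 + b))⁻¹) ^ a)
    (K k b : ℕ) (y : Site (F.P K) (1 + b)) (hY : blockSet K (1 + b) y ∈ canonLocRows q K k (Hist.triv (F.P K) k) (1 + b)) :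
    ∑ n ∈ Finset.Ico 2 7, ((n ! : ℝ))⁻¹ * ∑ c : Fin n → PBond (F.P K) b,
        ‖N (K + 1) (b + 1) (liftSite F K (1 + b) y) n (fun i => matchBond F K b (c i)) - N K b y n c‖ *
          (∏ i, Real.exp (κ' * canonLegDist F K b (blockSet K (1 + b) y) (c i))) * (ρ / 2) ^ n ≤
      (A * Real.exp (κ * (F.L : ℝ) ^ 3) *
          ∑ n ∈ Finset.Ico 2 7, ((n ! : ℝ))⁻¹ * (legSumConst F.L 𝔠 (κ₁ - κ') * (1 + (F.L : ℝ) ^ 3) * (ρ / 2)) ^ n) *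
        Real.exp (-κ * (AlphaInputsT3AC.dataOfCoreRows q (canonPolymerRows q)).treeLen K (1 + b) (blockSet K (1 + b) y)) *
        (((F.L : ℝ) ^ (1 + b))⁻¹) ^ a := by
  have hL : (0 : ℝ) < F.L := by exact_mod_cast (zero_lt_one.trans F.hL.2)
  -- the rate factor of chart level `b`
  set r : ℝ := (((F.L : ℝ) ^ (1 + b))⁻¹) ^ a with hr_def
  have hr : 0 < r := Real.rpow_pos_of_pos (by positivity) a
  -- the chart-level-`b` slice of the difference family (zero at the other chart levels): pointwise decay with the constant `A·r`
  set Ns : (K' b' : ℕ) → Site (F.P K') (1 + b') → (n : ℕ) → (Fin n → PBond (F.P K') b') →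
      ContinuousMultilinearMap ℂ (fun _ : Fin n => ↥(lieC (suGroupModel 2))) ℂ :=
    fun K' b' y' n c => if b' = b then N (K' + 1) (b' + 1) (liftSite F K' (1 + b') y') n (fun i => matchBond F K' b' (c i)) - N K' b' y' n c else 0
    with hNs
  have hpt : ∀ (K' k' b' : ℕ) (y' : Site (F.P K') (1 + b')), blockSet K' (1 + b') y' ∈ canonLocRows q K' k' (Hist.triv (F.P K') k') (1 + b') →
      ∀ n ∈ Finset.Ico 2 7, ∀ c : Fin n → PBond (F.P K') b',
        ‖Ns K' b' y' n c‖ ≤ A * r * ∏ i, Real.exp (-(κ₁ * canonLegDist F K' b' (blockSet K' (1 + b') y') (c i))) := by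
    intro K' k' b' y' hY' n hn c
    by_cases hb' : b' = b
    · subst hb'
      have hif : Ns K' b' y' n c = N (K' + 1) (b' + 1) (liftSite F K' (1 + b') y') n (fun i => matchBond F K' b' (c i)) - N K' b' y' n c := by
        rw [hNs]; exact if_pos rfl
      rw [hif]
      calc _ ≤ A * (∏ i, Real.exp (-(κ₁ * canonLegDist F K' b' (blockSet K' (1 + b') y') (c i)))) * r := hK0 K' k' b' y' hY' n hn c
        _ = _ := by ring
    · have hif : Ns K' b' y' n c = 0 := by rw [hNs]; exact if_neg hb'
      rw [hif, ContinuousMultilinearMap.opNorm_zero]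
      exact mul_nonneg (mul_nonneg hA hr.le) (Finset.prod_nonneg fun i _ => (Real.exp_pos _).le)
  have hB := kernelBudget_blockSet_of_pointwise q Ns hκ' hκ (mul_nonneg hA hr.le) hρ hpt K k b y hY
  have hslice : ∀ (n : ℕ) (c : Fin n → PBond (F.P K) b),
      ‖N (K + 1) (b + 1) (liftSite F K (1 + b) y) n (fun i => matchBond F K b (c i)) - N K b y n c‖ = ‖Ns K b y n c‖ := by
    intro n c
    rw [hNs]
    exact congrArg _ (if_pos rfl).symm
  calc ∑ n ∈ Finset.Ico 2 7, ((n ! : ℝ))⁻¹ * ∑ c : Fin n → PBond (F.P K) b,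
        ‖N (K + 1) (b + 1) (liftSite F K (1 + b) y) n (fun i => matchBond F K b (c i)) - N K b y n c‖ *
          (∏ i, Real.exp (κ' * canonLegDist F K b (blockSet K (1 + b) y) (c i))) * (ρ / 2) ^ n
      = ∑ n ∈ Finset.Ico 2 7, ((n ! : ℝ))⁻¹ * ∑ c : Fin n → PBond (F.P K) b,
          ‖Ns K b y n c‖ * (∏ i, Real.exp (κ' * canonLegDist F K b (blockSet K (1 + b) y) (c i))) * (ρ / 2) ^ n := by
        refine Finset.sum_congr rfl fun n _ => ?_
        congr 1
        refine Finset.sum_congr rfl fun c _ => ?_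
        rw [hslice]
    _ ≤ (A * r * Real.exp (κ * (F.L : ℝ) ^ 3) *
          ∑ n ∈ Finset.Ico 2 7, ((n ! : ℝ))⁻¹ * (legSumConst F.L 𝔠 (κ₁ - κ') * (1 + (F.L : ℝ) ^ 3) * (ρ / 2)) ^ n) *
        Real.exp (-κ * (AlphaInputsT3AC.dataOfCoreRows q (canonPolymerRows q)).treeLen K (1 + b) (blockSet K (1 + b) y)) := hB
    _ = _ := by rw [hr_def]; ring
set_option maxHeartbeats 400000 in
open Classical in
/-- ★★ **(K) `FlatKernelLegCauchyΦ` FOR THE NATURAL CHART FAMILY `Φ♮[Φ₀, N]` AT THE ROWS DATUM FROM TWO LETTERS**: (K_b) the background family's leg-weighted two-run kernel row OFF THE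
BLOCKS (`Y` listed, `Y` no level-`(1+b)` block's point set) with constant `C₀`, and (K₀) PRINT'S POINTWISE TWO-RUN ROW OF THE (43) KERNELS at the listed blocks, legs matched along
`matchBond`, blocks along `liftSite`: `‖N (K+1) (b+1) (liftSite y) n (matchBond ∘ c) − N K b y n c‖ ≤ A·Πᵢ e^{−κ₁·d(cᵢ)}·(L^{−(1+b)})^a` with a leg rate `κ₁ > κ′` — give (K) for
`Φ♮[Φ₀, N]` with decay `κ ≥ 0` and constant `max C₀ (A·e^{κL³}·Σ_{n∈[2,7)} (n!)⁻¹ (legSumConst(κ₁−κ′)(1+L³)·6)ⁿ)` (Cauchy radius `12`, factor `1`); (K_b) and (K₀) stay HYPOTHESES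
(the two cross-cut-off estimates, UNPRINTED for non-abelian `d = 3`).
[cite: King1986, Prop. 3.6 (3.55)-(3.56) p.662; Balaban1985UV3, (33)-(34) p.264, (43) p.266, (45) p.267; Balaban1987RG1, (0.1) p.251] -/
theorem flatKernelLegCauchyΦ_naturalChart_rows_of_offBlock_of_pointwise {κ' κ₁ κ a C₀ A : ℝ} (hκ' : κ' < κ₁) (hκ : 0 ≤ κ) (hA : 0 ≤ A)
    (hKb : ∀ (K k b : ℕ) (Y : Set (Site (F.P K) 0)), Y ∈ canonLocRows q K k (Hist.triv (F.P K) k) (1 + b) →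
      (∀ y : Site (F.P K) (1 + b), blockSet K (1 + b) y ≠ Y) → ∀ d ∈ Finset.Ico 2 7,
        ‖(kerT Φ₀ K b Y d - ker Φ₀ K b Y d).compContinuousLinearMap fun _ => legL ↥(lieC (suGroupModel 2)) (canonLegDist F) κ' K b Y‖ ≤
          C₀ * Real.exp (-κ * (AlphaInputsT3AC.dataOfCoreRows q (canonPolymerRows q)).treeLen K (1 + b) Y) * (((F.L : ℝ) ^ (1 + b))⁻¹) ^ a)
    (hK0 : ∀ (K k b : ℕ) (y : Site (F.P K) (1 + b)), blockSet K (1 + b) y ∈ canonLocRows q K k (Hist.triv (F.P K) k) (1 + b) →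
      ∀ n ∈ Finset.Ico 2 7, ∀ c : Fin n → PBond (F.P K) b,
        ‖N (K + 1) (b + 1) (liftSite F K (1 + b) y) n (fun i => matchBond F K b (c i)) - N K b y n c‖ ≤
          A * (∏ i, Real.exp (-(κ₁ * canonLegDist F K b (blockSet K (1 + b) y) (c i)))) * (((F.L : ℝ) ^ (1 + b))⁻¹) ^ a) :
    FlatKernelLegCauchyΦ (AlphaInputsT3AC.dataOfCoreRows q (canonPolymerRows q))
      (fun K b Y =>
        if h : ∃ y : Site (F.P K) (1 + b), blockSet K (1 + b) y = Y then
          (fun x : PBond (F.P K) b → ↥(lieC (suGroupModel 2)) =>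
            ∑ n ∈ Finset.Ico 2 7, ((n ! : ℂ))⁻¹ * ∑ c : Fin n → PBond (F.P K) b, N K b h.choose n c (fun i => x (c i)))
        else Φ₀ K b Y)
      (canonLegDist F) κ' κ a
      (max C₀ (A * Real.exp (κ * (F.L : ℝ) ^ 3) * ∑ n ∈ Finset.Ico 2 7, ((n ! : ℝ))⁻¹ * (legSumConst F.L 𝔠 (κ₁ - κ') * (1 + (F.L : ℝ) ^ 3) * 6) ^ n)) := by
  intro K k b Y hY d hd
  change Y ∈ canonLocRows q K k (Hist.triv (F.P K) k) (1 + b) at hY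
  have hbm : 1 + b ≤ F.m + K := one_add_le_of_mem_canonLocRows q hY
  have hd6 : d ≤ 6 := by have := (Finset.mem_Ico.mp hd).2; omega
  set CK : ℝ := A * Real.exp (κ * (F.L : ℝ) ^ 3) * ∑ n ∈ Finset.Ico 2 7, ((n ! : ℝ))⁻¹ * (legSumConst F.L 𝔠 (κ₁ - κ') * (1 + (F.L : ℝ) ^ 3) * 6) ^ n
  have he0 : 0 ≤ Real.exp (-κ * (AlphaInputsT3AC.dataOfCoreRows q (canonPolymerRows q)).treeLen K (1 + b) Y) := (Real.exp_pos _).le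
  have hL : (0 : ℝ) < F.L := by exact_mod_cast (zero_lt_one.trans F.hL.2)
  have hr0 : 0 ≤ (((F.L : ℝ) ^ (1 + b))⁻¹) ^ a := (Real.rpow_pos_of_pos (by positivity) a).le
  by_cases hblk : ∃ y : Site (F.P K) (1 + b), blockSet K (1 + b) y = Y
  · -- AT A LISTED BLOCK: the kernel polynomial of the difference family, Cauchy at radius 12, the pointwise budget
    obtain ⟨y, rfl⟩ := hblk
    rw [kerT_sub_ker_naturalChart_blockSet Φ₀ N hbm y d]
    have hB := twoRunKernelBudget_blockSet_of_pointwise q N hκ' hκ hA (show (0 : ℝ) ≤ 12 by norm_num) hK0 K k b y hY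
    have h := norm_iteratedFDeriv_legPoly_comp_legL_le (𝕍 := ↥(lieC (suGroupModel 2))) (canonLegDist F) κ' K b (blockSet K (1 + b) y)
      (fun n c => N (K + 1) (b + 1) (liftSite F K (1 + b) y) n (fun i => matchBond F K b (c i)) - N K b y n c) (show (0 : ℝ) < 12 by norm_num) hB hd6
    have h12 : (12 : ℝ) / 2 = 6 := by norm_num
    have hmax : max 1 ((12 : ℝ) / 12) = 1 := by norm_num
    rw [hmax, one_pow, mul_one, h12] at h
    refine h.trans ?_
    have hCK' : CK ≤ max C₀ CK := le_max_right _ _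
    exact mul_le_mul_of_nonneg_right (mul_le_mul_of_nonneg_right hCK' he0) hr0
  · -- OFF THE BLOCKS: both runs read the background family
    have hne : ∀ y : Site (F.P K) (1 + b), blockSet K (1 + b) y ≠ Y := fun y hy => hblk ⟨y, hy⟩
    have e1 := kerT_naturalChart_of_forall_ne Φ₀ N hbm hne d
    have e2 := ker_naturalChart_of_forall_ne Φ₀ N hne d
    simp only [e1, e2]
    refine (hKb K k b Y hY hne d hd).trans ?_
    have hC₀' : C₀ ≤ max C₀ CK := le_max_left _ _
    exact mul_le_mul_of_nonneg_right (mul_le_mul_of_nonneg_right hC₀' he0) hr0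

/-- The constant of `flatKernelLegCauchyΦ_naturalChart_rows_of_offBlock_of_pointwise` is nonnegative. [folklore] -/
theorem twoRunKernelConst_nonneg {κ' κ₁ κ C₀ A : ℝ} (hC₀ : 0 ≤ C₀) :
    0 ≤ max C₀ (A * Real.exp (κ * (F.L : ℝ) ^ 3) * ∑ n ∈ Finset.Ico 2 7, ((n ! : ℝ))⁻¹ * (legSumConst F.L 𝔠 (κ₁ - κ') * (1 + (F.L : ℝ) ^ 3) * 6) ^ n) :=
  hC₀.trans (le_max_left _ _)

end Rows

/-! ## §4 At the v4 χ-package: the (K) conjunct of the natural-object doors, letter for letter -/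

section Door

variable {F : T3Family} {𝔠 : AlphaConsts F.L (suGroupModel 2).N} {γ : ℝ} {hγ : 0 < γ} {hγ1 : γ ≤ (min 𝔠.gamma0 1) ^ 2}

open Classical in
/-- ★★ **THE (K) CONJUNCT OF THE NATURAL-OBJECT TWO-RUN DOORS** (✓`k1aLegRowsDisplayTwoRunChiAtV4_of_kernelRows` and its `Sel`/`Local` ports: `FlatKernelLegCauchyΦ (dataOfV4chi p
(canonPolymerRows (toRows ∘ p))) Φ♮[birthChartRows (toRows ∘ p), N] (canonLegDist F) κ′ 𝔠.κ a C`) FROM (K_b) the canonical birth chart family's two-run kernel row OFF THE BLOCKS and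
(K₀) THE POINTWISE TWO-RUN ROW OF THE (43) KERNELS at the listed blocks (`κ′ < κ₁`), `C := max C₀ (A·e^{𝔠.κ·L³}·Σ_{n∈[2,7)} (n!)⁻¹ (legSumConst(κ₁−κ′)(1+L³)·6)ⁿ)`.  HONEST: (K_b) (the birth
charts `Ψ_X + Λ_X` across the cut-offs) and (K₀) (the field-independent (43) kernels) are the definer's, UNPRINTED for non-abelian `d = 3` (E2 = NO); nothing of [King1986] is asserted.
[cite: King1986, Prop. 3.6 (3.55)-(3.56) p.662; Balaban1985UV3, (33)-(34) p.264, (43) p.266, (45) p.267, (61) p.271] -/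
theorem flatKernelLegCauchyΦ_naturalChart_chiV4_of_offBlock_of_pointwise (p : ∀ K, AlphaInputsT3AC.PkgAtV4Chi F 𝔠 γ hγ hγ1 K)
    (N : (K b : ℕ) → Site (F.P K) (1 + b) → (n : ℕ) → (Fin n → PBond (F.P K) b) → ContinuousMultilinearMap ℂ (fun _ : Fin n => ↥(lieC (suGroupModel 2))) ℂ)
    {κ' κ₁ a C₀ A : ℝ} (hκ' : κ' < κ₁) (hA : 0 ≤ A)
    (hKb : ∀ (K k b : ℕ) (Y : Set (Site (F.P K) 0)), Y ∈ canonLocRows (fun K => (p K).toRows) K k (Hist.triv (F.P K) k) (1 + b) →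
      (∀ y : Site (F.P K) (1 + b), blockSet K (1 + b) y ≠ Y) → ∀ d ∈ Finset.Ico 2 7,
        ‖(kerT (birthChartRows fun K => (p K).toRows) K b Y d - ker (birthChartRows fun K => (p K).toRows) K b Y d).compContinuousLinearMap
            fun _ => legL ↥(lieC (suGroupModel 2)) (canonLegDist F) κ' K b Y‖ ≤
          C₀ * Real.exp (-𝔠.κ * (AlphaInputsT3AC.dataOfV4chi p (canonPolymerRows fun K => (p K).toRows)).treeLen K (1 + b) Y) *
            (((F.L : ℝ) ^ (1 + b))⁻¹) ^ a)
    (hK0 : ∀ (K k b : ℕ) (y : Site (F.P K) (1 + b)), blockSet K (1 + b) y ∈ canonLocRows (fun K => (p K).toRows) K k (Hist.triv (F.P K) k) (1 + b) →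
      ∀ n ∈ Finset.Ico 2 7, ∀ c : Fin n → PBond (F.P K) b,
        ‖N (K + 1) (b + 1) (liftSite F K (1 + b) y) n (fun i => matchBond F K b (c i)) - N K b y n c‖ ≤
          A * (∏ i, Real.exp (-(κ₁ * canonLegDist F K b (blockSet K (1 + b) y) (c i)))) * (((F.L : ℝ) ^ (1 + b))⁻¹) ^ a) :
    FlatKernelLegCauchyΦ (AlphaInputsT3AC.dataOfV4chi p (canonPolymerRows fun K => (p K).toRows))
      (fun K b Y =>
        if h : ∃ y : Site (F.P K) (1 + b), blockSet K (1 + b) y = Y then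
          (fun x : PBond (F.P K) b → ↥(lieC (suGroupModel 2)) =>
            ∑ n ∈ Finset.Ico 2 7, ((n ! : ℂ))⁻¹ * ∑ c : Fin n → PBond (F.P K) b, N K b h.choose n c (fun i => x (c i)))
        else birthChartRows (fun K => (p K).toRows) K b Y)
      (canonLegDist F) κ' 𝔠.κ a
      (max C₀ (A * Real.exp (𝔠.κ * (F.L : ℝ) ^ 3) * ∑ n ∈ Finset.Ico 2 7, ((n ! : ℝ))⁻¹ * (legSumConst F.L 𝔠 (κ₁ - κ') * (1 + (F.L : ℝ) ^ 3) * 6) ^ n)) :=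
  flatKernelLegCauchyΦ_naturalChart_rows_of_offBlock_of_pointwise (fun K => (p K).toRows) (birthChartRows fun K => (p K).toRows) N hκ'
    (kappa_record_admissible 𝔠).1.le hA hKb hK0

end Door

end Summit.QuantumFields.YangMills.Theorems.GlobalSlackKernelLeg

end
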